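import Mathlib.RingTheory.PowerSeries.Substitution
import Mathlib.RingTheory.PowerSeries.Expand
import Mathlib.RingTheory.PowerSeries.Derivative
import Mathlib.RingTheory.PowerSeries.Trunc
import Mathlib.RingTheory.PowerSeries.Order
import Mathlib.RingTheory.PowerSeries.NoZeroDivisors
import Mathlib.Algebra.Polynomial.Taylor
import Mathlib.Algebra.CharP.Frobenius
import Mathlib.Algebra.CharP.Quotient
import Mathlib.RingTheory.Ideal.Quotient.Basic
import Mathlib.NumberTheory.Padics.RingHoms
import Mathlib.RingTheory.WittVector.Identities
import Mathlib.RingTheory.WittVector.Domain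
import Mathlib.FieldTheory.Perfect
import Literature.NumberTheory.EllipticCurves.DivisionPolynomialFormalMulProofs
import Literature.NumberTheory.EllipticCurves.FormalGroupHasseInvariantProofs
import Literature.RingTheory.FormalGroups.FunctionalEquationIntegrality
import Literature.NumberTheory.EllipticCurves.FormalGroupMultiplicationUniversalProofs
import Literature.NumberTheory.EllipticCurves.FormalGroupLogHomProofs
import Literature.RingTheory.FormalGroups.HondaTypeTransport
import Literature.NumberTheory.EllipticCurves.FormalMulTwoSecondCoeffProofs
import Mathlib.RingTheory.WittVector.FrobeniusFractionField
import Mathlib.RingTheory.WittVector.Compare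
import Mathlib.FieldTheory.Finite.Basic
import Literature.NumberTheory.EllipticCurves.FormalLogExpBaseChangeProofs
import Summits.BirchSwinnertonDyer.BirchSwinnertonDyer.Theorems.EisensteinDepletionAtTwoStarGO2KEtaHondaTheoremKWitt
import HarnessLib

/-!
# THEOREM K (the 2-adic Kummer class law for `z²(x(z) − x₀)`), kernel formalisation — KEtaWittFrac
(crux `StarGO2Sigma`, stmt-BirchSwinnertonDyer-27046; line kummer, research stub `stub_discrepancyCover`)

Planner bsd-rank2-p2 GEN 36–37's K-UNIV / K-ETA kernel files (HOME/p2/g37/lean, memo K-UNIV.md; monolith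
`KummerTheoremK_full.lean`, lean rc 0, 0 sorries), landed by the lead star-p1 GEN 12 in ≤ 400-line parts, verbatim except for
file packaging.  This part: (K-h) part 2: the fraction field of `𝕎(k)` (char 0, Dwork–Hazewinkel hypotheses hA/hK/hαA/hα) and the transport `ℚ₂ → Frac 𝕎(k)`: integrality of `exp(c₀·log_W)` (`coeff_exp_subst_mem`, `exists_map_eq_exp_subst`).
Nothing here reads `r_an`; `StarGO2Sigma` / E1M / BSD are NOT proved by this file.
-/

set_option linter.dupNamespace false
set_option linter.unusedSectionVars false
set_option autoImplicit false

noncomputable section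

open PowerSeries

namespace Summit.BirchSwinnertonDyer.BirchSwinnertonDyer.Theorems.DepletionAtTwo.KEta.WittExistence

section Frac

variable (k : Type*) [Field k] [IsAlgClosed k] [CharP k 2]

/-- `Frac 𝕎(k)` has characteristic `0`. [folklore] -/
theorem charZero_fractionRing : CharZero (FractionRing (WittVector 2 k)) := by
  refine charZero_of_inj_zero fun n hn => ?_
  by_contra hn0
  have hO : (n : WittVector 2 k) = 0 := by
    have h := (IsFractionRing.injective (WittVector 2 k) (FractionRing (WittVector 2 k)))
    apply h; rw [map_natCast, map_zero]; exact hn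
  -- write `n = 2^v m`, `m` odd
  obtain ⟨v, m, hm, hnm⟩ := Nat.exists_eq_two_pow_mul_odd hn0
  have hm0 : (m : WittVector 2 k) ≠ 0 := by
    intro h0
    have h1 := congrArg (WittVector.constantCoeff : WittVector 2 k →+* k) h0
    rw [map_natCast, map_zero] at h1
    have h2 : (2 : ℕ) ∣ m := (CharP.cast_eq_zero_iff k 2 m).mp h1
    exact (Nat.not_even_iff_odd.mpr hm) (even_iff_two_dvd.mpr h2)
  have h2 : (2 : WittVector 2 k) ^ v ≠ 0 := by
    have := WittVector.p_nonzero 2 k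
    exact pow_ne_zero _ (by exact_mod_cast this)
  rw [hnm, Nat.cast_mul, Nat.cast_pow, Nat.cast_ofNat] at hO
  exact (mul_ne_zero h2 hm0) hO

/-- The subring `𝕎(k) ⊆ Frac 𝕎(k)`. -/
def intRange : Subring (FractionRing (WittVector 2 k)) :=
  (algebraMap (WittVector 2 k) (FractionRing (WittVector 2 k))).range

/-- K-UNIV kernel lemma (THEOREM K formalisation, p2 GEN 37); see the file docstring. [folklore] -/
theorem mem_intRange_iff {x : FractionRing (WittVector 2 k)} :
    x ∈ intRange k ↔ ∃ b : WittVector 2 k, algebraMap _ _ b = x := RingHom.mem_range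

/-- K-UNIV kernel lemma (THEOREM K formalisation, p2 GEN 37); see the file docstring. [folklore] -/
theorem algebraMap_mem_intRange (b : WittVector 2 k) :
    algebraMap (WittVector 2 k) (FractionRing (WittVector 2 k)) b ∈ intRange k := ⟨b, rfl⟩

/-- (hA) `1/m ∈ 𝕎(k)` for odd `m`. [folklore] -/
theorem hA [Algebra ℚ (FractionRing (WittVector 2 k))] (m : ℕ) (hm : ¬ 2 ∣ m) :
    algebraMap ℚ (FractionRing (WittVector 2 k)) (1 / m) ∈ intRange k := by
  have hm0 : ((m : WittVector 2 k)).coeff 0 ≠ 0 := by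
    intro h0
    have h1 : ((m : WittVector 2 k)).coeff 0 = (m : k) := by
      rw [← WittVector.constantCoeff_apply, map_natCast]
    rw [h1] at h0
    exact hm ((CharP.cast_eq_zero_iff k 2 m).mp h0)
  obtain ⟨u, hu⟩ := WittVector.isUnit_of_coeff_zero_ne_zero _ hm0
  refine ⟨↑u⁻¹, ?_⟩
  rw [map_div₀, map_one, map_natCast, one_div]
  have hK : algebraMap (WittVector 2 k) (FractionRing (WittVector 2 k)) (m : WittVector 2 k) =
      (m : FractionRing (WittVector 2 k)) := map_natCast _ m
  rw [← hK, ← hu, ← map_units_inv]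

/-- (hK) every `x ∈ Frac 𝕎(k)` has `2^j x ∈ 𝕎(k)` for some `j`. [folklore] -/
theorem hK (x : FractionRing (WittVector 2 k)) :
    ∃ j : ℕ, (2 : FractionRing (WittVector 2 k)) ^ j * x ∈ intRange k := by
  obtain ⟨a, b, hb, rfl⟩ := IsFractionRing.div_surjective (A := WittVector 2 k) x
  have hb0 : b ≠ 0 := nonZeroDivisors.ne_zero hb
  obtain ⟨m, u, hbu⟩ := WittVector.exists_eq_pow_p_mul' b hb0
  refine ⟨m, a * ↑u⁻¹, ?_⟩
  have h2 : algebraMap (WittVector 2 k) (FractionRing (WittVector 2 k)) b =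
      (2 : FractionRing (WittVector 2 k)) ^ m * algebraMap _ _ (u : WittVector 2 k) := by
    rw [hbu, map_mul, map_pow, Nat.cast_ofNat, map_ofNat]
  have hu0 : algebraMap (WittVector 2 k) (FractionRing (WittVector 2 k)) (u : WittVector 2 k) ≠ 0 :=
    fun h => u.ne_zero ((IsFractionRing.injective (WittVector 2 k) (FractionRing (WittVector 2 k)))
      (h.trans (map_zero _).symm))
  have h20 : (2 : FractionRing (WittVector 2 k)) ^ m ≠ 0 :=
    pow_ne_zero _ (by exact_mod_cast WittVector.FractionRing.p_nonzero 2 k)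
  rw [h2, map_mul, map_units_inv]
  field_simp

/-- The Frobenius of `Frac 𝕎(k)`. -/
def fracFrobenius : FractionRing (WittVector 2 k) →+* FractionRing (WittVector 2 k) :=
  (IsFractionRing.ringEquivOfRingEquiv (WittVector.frobeniusEquiv 2 k) :
    FractionRing (WittVector 2 k) ≃+* FractionRing (WittVector 2 k)).toRingHom

/-- K-UNIV kernel lemma (THEOREM K formalisation, p2 GEN 37); see the file docstring. [folklore] -/
theorem fracFrobenius_algebraMap (b : WittVector 2 k) :
    fracFrobenius k (algebraMap _ _ b) = algebraMap _ _ (WittVector.frobenius b) := by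
  rw [fracFrobenius, RingEquiv.toRingHom_eq_coe, RingHom.coe_coe,
    IsFractionRing.ringEquivOfRingEquiv_algebraMap]
  rfl

/-- (hαA) `σ(𝕎) ⊆ 𝕎`. -/
theorem hαA (r : FractionRing (WittVector 2 k)) (hr : r ∈ intRange k) : fracFrobenius k r ∈ intRange k := by
  obtain ⟨b, rfl⟩ := hr
  rw [fracFrobenius_algebraMap]
  exact algebraMap_mem_intRange k _

/-- (hα) `σ(r) ≡ r² (mod 2)` on `𝕎(k)`. -/
theorem hα (r : FractionRing (WittVector 2 k)) (hr : r ∈ intRange k) :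
    ∃ a ∈ intRange k, fracFrobenius k r = r ^ 2 + 2 * a := by
  obtain ⟨b, rfl⟩ := hr
  have h0 : (WittVector.frobenius b - b ^ 2).coeff 0 = 0 := by
    rw [← WittVector.constantCoeff_apply, map_sub, map_pow, WittVector.constantCoeff_apply,
      WittVector.constantCoeff_apply, WittVector.coeff_frobenius_charP, sub_self]
  obtain ⟨y, hy⟩ := exists_eq_two_mul_of_coeff_zero h0
  refine ⟨algebraMap _ _ y, algebraMap_mem_intRange k y, ?_⟩
  rw [fracFrobenius_algebraMap, ← map_pow, show WittVector.frobenius b = b ^ 2 + 2 * y by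
    rw [← hy]; ring, map_add, map_mul, map_ofNat]

end Frac

end Summit.BirchSwinnertonDyer.BirchSwinnertonDyer.Theorems.DepletionAtTwo.KEta.WittExistence

namespace Summit.BirchSwinnertonDyer.BirchSwinnertonDyer.Theorems.DepletionAtTwo.KEta.WittExistence

/-! ### Transport `ℚ₂ → Frac 𝕎(k)` and integrality of `exp(c₀·log_W)` -/

section Transport

open Literature.RingTheory.FormalGroups

variable (k : Type*) [Field k] [IsAlgClosed k] [CharP k 2]

/-- `j : ℚ₂ → Frac 𝕎(k)`, the extension of `ι` to fraction fields. [folklore] -/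
def jmap : ℚ_[2] →+* FractionRing (WittVector 2 k) :=
  IsFractionRing.lift (A := ℤ_[2]) (K := ℚ_[2])
    (g := (algebraMap (WittVector 2 k) (FractionRing (WittVector 2 k))).comp (iota k))
    ((IsFractionRing.injective (WittVector 2 k) (FractionRing (WittVector 2 k))).comp
      (iota_injective k))

/-- K-UNIV kernel lemma (THEOREM K formalisation, p2 GEN 37); see the file docstring. [folklore] -/
theorem jmap_coe (x : ℤ_[2]) :
    jmap k (x : ℚ_[2]) = algebraMap (WittVector 2 k) (FractionRing (WittVector 2 k)) (iota k x) := by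
  rw [← PadicInt.algebraMap_apply, jmap, IsFractionRing.lift_algebraMap, RingHom.comp_apply]

variable [Algebra ℚ (FractionRing (WittVector 2 k))]

/-- `j_*(log_{W/ℚ₂}) = log_{W/K}`. [folklore] -/
theorem formalLog_map_jmap (W : WeierstrassCurve ℤ) :
    PowerSeries.map (jmap k) (W.map (Int.castRingHom ℚ_[2])).formalLog =
      (W.map (Int.castRingHom (FractionRing (WittVector 2 k)))).formalLog := by
  rw [WeierstrassCurve.map_formalLog, WeierstrassCurve.map_map]
  congr 2
  exact RingHom.ext_int _ _

/-- `σ_*(log_{W/K}) = log_{W/K}` (`W` is defined over `ℤ`). [folklore] -/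
theorem formalLog_map_fracFrobenius (W : WeierstrassCurve ℤ) :
    PowerSeries.map (fracFrobenius k) (W.map (Int.castRingHom (FractionRing (WittVector 2 k)))).formalLog =
      (W.map (Int.castRingHom (FractionRing (WittVector 2 k)))).formalLog := by
  rw [WeierstrassCurve.map_formalLog, WeierstrassCurve.map_map]
  congr 2
  exact RingHom.ext_int _ _

/-- The integral `λ`-series `Λ ∈ ℤ₂⟦X⟧` (`Λ ↦ λ_α(log_{W/ℚ₂}) = log − (α/2)·log(X²)`), from the Honda
type via `HondaLambda.norm_coeff_frobLambda_le_one`. [K-UNIV.md §2.9] -/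
def lamInt (W : WeierstrassCurve ℤ) (a : ℤ) {α : ℤ_[2]} (hαn : ‖α‖ = 1)
    (hroot : (α : ℚ_[2]) ^ 2 - a * α + 2 = 0)
    (hH : ∀ n, ‖coeff n (hondaShift 2 (a : ℚ_[2]) (W.map (Int.castRingHom ℚ_[2])).formalLog)‖ ≤ 1) :
    PowerSeries ℤ_[2] :=
  PowerSeries.mk fun n =>
    ⟨coeff n (HondaLambda.frobLambda (α : ℚ_[2]) (W.map (Int.castRingHom ℚ_[2])).formalLog),
      HondaLambda.norm_coeff_frobLambda_le_one (p := 2) (a := (a : ℚ_[2])) hαn (by exact_mod_cast hroot)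
        (WeierstrassCurve.constantCoeff_formalLog _) (by exact_mod_cast hH) n⟩

/-- K-UNIV kernel lemma (THEOREM K formalisation, p2 GEN 37); see the file docstring. [folklore] -/
theorem coe_coeff_lamInt (W : WeierstrassCurve ℤ) (a : ℤ) {α : ℤ_[2]} (hαn : ‖α‖ = 1)
    (hroot : (α : ℚ_[2]) ^ 2 - a * α + 2 = 0)
    (hH : ∀ n, ‖coeff n (hondaShift 2 (a : ℚ_[2]) (W.map (Int.castRingHom ℚ_[2])).formalLog)‖ ≤ 1)
    (n : ℕ) :
    ((coeff n (lamInt W a hαn hroot hH) : ℤ_[2]) : ℚ_[2]) =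
      coeff n (HondaLambda.frobLambda (α : ℚ_[2]) (W.map (Int.castRingHom ℚ_[2])).formalLog) := by
  rw [lamInt, coeff_mk]

/-- K-UNIV kernel lemma (THEOREM K formalisation, p2 GEN 37); see the file docstring. [folklore] -/
theorem constantCoeff_lamInt (W : WeierstrassCurve ℤ) (a : ℤ) {α : ℤ_[2]} (hαn : ‖α‖ = 1)
    (hroot : (α : ℚ_[2]) ^ 2 - a * α + 2 = 0)
    (hH : ∀ n, ‖coeff n (hondaShift 2 (a : ℚ_[2]) (W.map (Int.castRingHom ℚ_[2])).formalLog)‖ ≤ 1) :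
    constantCoeff (lamInt W a hαn hroot hH) = 0 := by
  have h : ((constantCoeff (lamInt W a hαn hroot hH) : ℤ_[2]) : ℚ_[2]) = 0 := by
    rw [← coeff_zero_eq_constantCoeff_apply, coe_coeff_lamInt, coeff_zero_eq_constantCoeff_apply,
      HondaLambda.constantCoeff_frobLambda (WeierstrassCurve.constantCoeff_formalLog _)]
  exact Subtype.val_injective (h.trans PadicInt.coe_zero.symm)

/-- **The functional-equation defect of `a = c₀·log_{W/K}`, coefficientwise**:
`[Xⁿ](a − ½·expand₂(σ_K,* a)) = c₀ · ι(Λ_n)` in `𝕎(k) ⊆ K`. [K-UNIV.md §2.8] -/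
theorem coeff_defect_eq (W : WeierstrassCurve ℤ) (a : ℤ) {α : ℤ_[2]} (hαn : ‖α‖ = 1)
    (hroot : (α : ℚ_[2]) ^ 2 - a * α + 2 = 0)
    (hH : ∀ n, ‖coeff n (hondaShift 2 (a : ℚ_[2]) (W.map (Int.castRingHom ℚ_[2])).formalLog)‖ ≤ 1)
    (n : ℕ) :
    coeff n (C (algebraMap (WittVector 2 k) (FractionRing (WittVector 2 k))
          (period (k := k) (PadicInt.isUnit_iff.mpr hαn))) *
          (W.map (Int.castRingHom (FractionRing (WittVector 2 k)))).formalLog -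
        (2 : ℚ)⁻¹ • expand 2 two_ne_zero
          (PowerSeries.map (fracFrobenius k)
            (C (algebraMap (WittVector 2 k) (FractionRing (WittVector 2 k))
                (period (k := k) (PadicInt.isUnit_iff.mpr hαn))) *
              (W.map (Int.castRingHom (FractionRing (WittVector 2 k)))).formalLog))) =
      algebraMap (WittVector 2 k) (FractionRing (WittVector 2 k))
        (period (k := k) (PadicInt.isUnit_iff.mpr hαn) * iota k (coeff n (lamInt W a hαn hroot hH))) := by
  have hαu : IsUnit α := PadicInt.isUnit_iff.mpr hαn
  have hLKfix : ∀ m, fracFrobenius k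
      (coeff m (W.map (Int.castRingHom (FractionRing (WittVector 2 k)))).formalLog) =
      coeff m (W.map (Int.castRingHom (FractionRing (WittVector 2 k)))).formalLog := fun m => by
    have h := congrArg (coeff m) (formalLog_map_fracFrobenius k W)
    rwa [coeff_map] at h
  have hLKj : ∀ m, coeff m (W.map (Int.castRingHom (FractionRing (WittVector 2 k)))).formalLog =
      jmap k (coeff m (W.map (Int.castRingHom ℚ_[2])).formalLog) := fun m => by
    have h := congrArg (coeff m) (formalLog_map_jmap k W)
    rw [coeff_map] at h
    exact h.symm
  have hcK : fracFrobenius k (algebraMap (WittVector 2 k) (FractionRing (WittVector 2 k))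
      (period (k := k) hαu)) =
      algebraMap _ _ (period (k := k) hαu) * algebraMap _ _ (iota k α) := by
    rw [fracFrobenius_algebraMap, frobenius_period, map_mul]
  have h2 : ((2 : ℚ)⁻¹ : ℚ) • (1 : FractionRing (WittVector 2 k)) =
      (2 : FractionRing (WittVector 2 k))⁻¹ := by
    rw [Algebra.smul_def, mul_one, map_inv₀, map_ofNat]
  rw [map_mul (algebraMap (WittVector 2 k) (FractionRing (WittVector 2 k))) (period (k := k) hαu)
      (iota k (coeff n (lamInt W a hαn hroot hH))), ← jmap_coe k (coeff n (lamInt W a hαn hroot hH)),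
    coe_coeff_lamInt, map_sub, coeff_C_mul, coeff_smul, coeff_expand, HondaLambda.coeff_frobLambda]
  by_cases h2n : 2 ∣ n
  · rw [if_pos h2n, if_pos h2n, coeff_map, coeff_C_mul, map_mul, hcK, hLKfix, map_sub, map_mul,
      map_div₀, map_natCast, jmap_coe, ← hLKj, ← hLKj, ← smul_one_mul ((2 : ℚ)⁻¹), h2,
      Nat.cast_ofNat]
    ring
  · rw [if_neg h2n, if_neg h2n, mul_zero, sub_zero, ← hLKj]
    simp

/-- **(K-h) integrality.** For `W/ℤ` whose `2`-adic formal logarithm is of Honda type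
`2 − a T + T²` (`hH`, the tree's `norm_coeff_hondaShift_formalLog_le_one'` supplies it with
`a = a₂(E)`) and a unit root `α ∈ ℤ₂` of `X² − aX + 2`: every coefficient of
`exp(c₀ · log_W) ∈ K⟦X⟧`, `c₀ = period(α)`, lies in `𝕎(k)`.  Dwork–Hazewinkel–Blakestad–Grant
engine `coeff_exp_subst_mem_of_functionalEquation` with the Witt Frobenius; the functional-equation
defect is `c₀ · j_*(λ_α)` (`coeff_defect_eq`). [K-UNIV.md §2.8–2.9] -/
theorem coeff_exp_subst_mem (W : WeierstrassCurve ℤ) (a : ℤ) {α : ℤ_[2]} (hαn : ‖α‖ = 1)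
    (hroot : (α : ℚ_[2]) ^ 2 - a * α + 2 = 0)
    (hH : ∀ n, ‖coeff n (hondaShift 2 (a : ℚ_[2]) (W.map (Int.castRingHom ℚ_[2])).formalLog)‖ ≤ 1)
    (n : ℕ) :
    coeff n ((exp (FractionRing (WittVector 2 k))).subst
      (C (algebraMap (WittVector 2 k) (FractionRing (WittVector 2 k))
          (period (k := k) (PadicInt.isUnit_iff.mpr hαn))) *
        (W.map (Int.castRingHom (FractionRing (WittVector 2 k)))).formalLog)) ∈ intRange k := by
  revert n
  refine coeff_exp_subst_mem_of_functionalEquation 2 (intRange k) (fracFrobenius k) (hA k) (hK k)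
    (hαA k) (hα k) ?_ ?_
  · rw [map_mul, WeierstrassCurve.constantCoeff_formalLog, mul_zero]
  · intro n
    rw [Nat.cast_ofNat, coeff_defect_eq k W a hαn hroot hH n]
    exact algebraMap_mem_intRange k _

/-- **(K-h) existence of the comparison function.** Under the hypotheses of `coeff_exp_subst_mem`
there is `F₀ ∈ 𝕎(k)⟦X⟧` with `F₀ ↦ exp(c₀·log_W)` in `K⟦X⟧`. [K-UNIV.md §2.8] -/
theorem exists_map_eq_exp_subst (W : WeierstrassCurve ℤ) (a : ℤ) {α : ℤ_[2]} (hαn : ‖α‖ = 1)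
    (hroot : (α : ℚ_[2]) ^ 2 - a * α + 2 = 0)
    (hH : ∀ n, ‖coeff n (hondaShift 2 (a : ℚ_[2]) (W.map (Int.castRingHom ℚ_[2])).formalLog)‖ ≤ 1) :
    ∃ F₀ : PowerSeries (WittVector 2 k),
      PowerSeries.map (algebraMap (WittVector 2 k) (FractionRing (WittVector 2 k))) F₀ =
        (exp (FractionRing (WittVector 2 k))).subst
          (C (algebraMap (WittVector 2 k) (FractionRing (WittVector 2 k))
              (period (k := k) (PadicInt.isUnit_iff.mpr hαn))) *
            (W.map (Int.castRingHom (FractionRing (WittVector 2 k)))).formalLog) := by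
  choose f hf using fun n => (mem_intRange_iff k).mp (coeff_exp_subst_mem k W a hαn hroot hH n)
  exact ⟨PowerSeries.mk f, by ext n; rw [coeff_map, coeff_mk, hf]⟩

end Transport

end Summit.BirchSwinnertonDyer.BirchSwinnertonDyer.Theorems.DepletionAtTwo.KEta.WittExistence

end
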